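import Literature.Probability.LatticeModels.IsingFieldUniqueness
import HarnessLib

/-!
# Insensitivity to the `±` boundary condition for observables of finitely many spins, and
# small general lemmas for the model with a site-dependent field

Topic `Probability/LatticeModels`; continues `IsingFieldModel`, `IsingFieldVolume`,
`IsingFieldUniqueness`. Finite-volume forms of two steps of the proof of Friedli–Velenik 2017,
Theorem 3.34 ("uniqueness iff `⟨σ_0⟩⁺ = ⟨σ_0⟩⁻`"):

* **DLR consistency in expectation form** (`fieldExpect_fixed_eq_of_forall_inner_eq`; Lemma 6.7,
  eq. (6.5)): `⟨F⟩^η_Λ` is an average of the inner expectations `⟨F⟩^{η[τ₂]}_{Λ'}`, `Λ' ⊆ Λ`.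
* **The FKG trick of Lemma 3.33 in Lipschitz form** (`abs_fieldExpect_plus_sub_minus_le`): for
  `β ≥ 0`, any field and `f` with `|f(σ') - f(σ)| ≤ M ∑_{k∈K} |σ'_k - σ_k|`,
  `|⟨f⟩⁺_Λ - ⟨f⟩⁻_Λ| ≤ M ∑_{k∈K} (⟨σ_k⟩⁺_Λ - ⟨σ_k⟩⁻_Λ)` (both `M∑_{k∈K}σ_k ± f` are nondecreasing —
  Lemma 3.33: "`∑_{i∈A} n_i - n_A` is non-decreasing" — and `⟨·⟩⁻ ≤ ⟨·⟩⁺` on nondecreasing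
  functions); every observable of the spins in a finite `K` is such an `f`
  (`exists_abs_le_of_local`, `abs_sub_le_of_local`), whence
  `tendsto_fieldExpect_plus_sub_minus_of_local`: if `⟨σ_k⟩⁺_{Λₙ} - ⟨σ_k⟩⁻_{Λₙ} → 0` for all
  `k ∈ K` then `⟨f⟩⁺_{Λₙ} - ⟨f⟩⁻_{Λₙ} → 0` (proof of Theorem 3.34, (3.37)).
* Bookkeeping: `tendsto_div_sub_div_atTop_nhds_zero` (ratios of merging bounded sequences merge),
  `edgeBoundary_mono_graph`, and the transport of the finite-volume uniqueness statement of
  `IsingFieldUniqueness` along a field-preserving automorphism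
  (`forall_volume_plusMag_sub_minusMag_le_equiv`, periodicity).

## References

* S. Friedli, Y. Velenik, *Statistical Mechanics of Lattice Systems* (CUP 2017), Lemma 3.33,
  Theorem 3.34 (proof, (3.37)), Prop. 3.29 (proof), Lemma 6.7 (eq. (6.5)).
-/

noncomputable section

open MeasureTheory Finset Filter Topology

namespace Literature.Probability.LatticeModels

section Local

variable {V : Type*}

/-- An observable depending only on the spins in a finite set `K` is bounded. [folklore] -/
theorem exists_abs_le_of_local (K : Finset V) {f : SpinConfig V → ℝ}
    (hloc : ∀ σ σ' : SpinConfig V, (∀ k ∈ K, σ k = σ' k) → f σ = f σ') :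
    ∃ B : ℝ, 0 ≤ B ∧ ∀ σ, |f σ| ≤ B := by
  classical
  let e : (K → ℤˣ) → SpinConfig V := fun τ x => if hx : x ∈ K then τ ⟨x, hx⟩ else 1
  refine ⟨∑ τ : K → ℤˣ, |f (e τ)|, Finset.sum_nonneg fun _ _ => abs_nonneg _, fun σ => ?_⟩
  have hσ : f σ = f (e fun k => σ k) := hloc σ _ fun k hk => by simp [e, hk]
  rw [hσ]
  exact Finset.single_le_sum (f := fun τ : K → ℤˣ => |f (e τ)|) (fun _ _ => abs_nonneg _)
    (Finset.mem_univ (fun k : K => σ k))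

/-- A bounded observable depending only on the spins in `K` is Lipschitz in those spins:
`|f(σ') - f(σ)| ≤ ‖f‖_∞ ∑_{k∈K} |σ'_k - σ_k|` (two distinct spin values differ by `2`).
[folklore] -/
theorem abs_sub_le_of_local (K : Finset V) {f : SpinConfig V → ℝ} {B : ℝ} (hB : ∀ σ, |f σ| ≤ B)
    (hloc : ∀ σ σ' : SpinConfig V, (∀ k ∈ K, σ k = σ' k) → f σ = f σ')
    (σ σ' : SpinConfig V) :
    |f σ' - f σ| ≤ B * ∑ k ∈ K, |spinAt k σ' - spinAt k σ| := by
  have hB0 : 0 ≤ B := (abs_nonneg _).trans (hB σ)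
  by_cases hK : ∀ k ∈ K, σ k = σ' k
  · rw [hloc σ σ' hK, sub_self, abs_zero]
    exact mul_nonneg hB0 (Finset.sum_nonneg fun _ _ => abs_nonneg _)
  · push Not at hK
    obtain ⟨k, hk, hne⟩ := hK
    have hne' : spinAt k σ ≠ spinAt k σ' := fun h => hne (Units.ext (by
      have h' : ((σ k : ℤ) : ℝ) = ((σ' k : ℤ) : ℝ) := h
      exact_mod_cast h'))
    have h2 : (2 : ℝ) ≤ |spinAt k σ' - spinAt k σ| := by
      rcases spinAt_eq_one_or_eq_neg_one k σ with h1 | h1 <;>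
        rcases spinAt_eq_one_or_eq_neg_one k σ' with h2 | h2 <;>
        rw [h1, h2] at hne' ⊢ <;> first | exact absurd rfl hne' | norm_num
    have hsum : (2 : ℝ) ≤ ∑ k ∈ K, |spinAt k σ' - spinAt k σ| :=
      h2.trans (Finset.single_le_sum (f := fun k => |spinAt k σ' - spinAt k σ|)
        (fun _ _ => abs_nonneg _) hk)
    calc |f σ' - f σ| ≤ |f σ'| + |f σ| := abs_sub _ _
      _ ≤ B + B := add_le_add (hB σ') (hB σ)
      _ = B * 2 := by ring
      _ ≤ B * ∑ k ∈ K, |spinAt k σ' - spinAt k σ| := mul_le_mul_of_nonneg_left hsum hB0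

/-- **Ratios of close quantities are close**: if `aₙ - a'ₙ → 0`, `bₙ - b'ₙ → 0`, `|aₙ|, |a'ₙ| ≤ A`
and `bₙ, b'ₙ ≥ b₀ > 0`, then `aₙ/bₙ - a'ₙ/b'ₙ → 0`. [folklore] -/
theorem tendsto_div_sub_div_atTop_nhds_zero {a a' b b' : ℕ → ℝ} {A b₀ : ℝ} (hb₀ : 0 < b₀)
    (ha : ∀ n, |a n| ≤ A) (ha' : ∀ n, |a' n| ≤ A) (hb : ∀ n, b₀ ≤ b n) (hb' : ∀ n, b₀ ≤ b' n)
    (hda : Tendsto (fun n => a n - a' n) atTop (𝓝 0))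
    (hdb : Tendsto (fun n => b n - b' n) atTop (𝓝 0)) :
    Tendsto (fun n => a n / b n - a' n / b' n) atTop (𝓝 0) := by
  have hA : 0 ≤ A := (abs_nonneg _).trans (ha 0)
  have key : ∀ n, |a n / b n - a' n / b' n| ≤
      |a n - a' n| / b₀ + A / b₀ ^ 2 * |b n - b' n| := by
    intro n
    have hbn : 0 < b n := hb₀.trans_le (hb n)
    have hb'n : 0 < b' n := hb₀.trans_le (hb' n)
    have e : a n / b n - a' n / b' n =
        (a n - a' n) / b n + a' n * (b' n - b n) / (b n * b' n) := by
      field_simp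
      ring
    rw [e]
    refine (abs_add_le _ _).trans (add_le_add ?_ ?_)
    · rw [abs_div, abs_of_pos hbn]
      exact div_le_div_of_nonneg_left (abs_nonneg _) hb₀ (hb n)
    · rw [abs_div, abs_mul, abs_of_pos (mul_pos hbn hb'n), abs_sub_comm (b' n) (b n),
        div_le_iff₀ (mul_pos hbn hb'n)]
      calc |a' n| * |b n - b' n| ≤ A * |b n - b' n| :=
            mul_le_mul_of_nonneg_right (ha' n) (abs_nonneg _)
        _ = A / b₀ ^ 2 * |b n - b' n| * (b₀ * b₀) := by
            field_simp
        _ ≤ A / b₀ ^ 2 * |b n - b' n| * (b n * b' n) :=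
            mul_le_mul_of_nonneg_left (mul_le_mul (hb n) (hb' n) hb₀.le hbn.le)
              (mul_nonneg (div_nonneg hA (sq_nonneg _)) (abs_nonneg _))
  have hlim : Tendsto (fun n => |a n - a' n| / b₀ + A / b₀ ^ 2 * |b n - b' n|) atTop (𝓝 0) := by
    have h1 := hda.abs
    have h2 := hdb.abs
    rw [abs_zero] at h1 h2
    have := (h1.div_const b₀).add (h2.const_mul (A / b₀ ^ 2))
    simpa using this
  exact squeeze_zero_norm (fun n => by rw [Real.norm_eq_abs]; exact key n) hlim

end Local

section General

variable {V : Type*} (G : SimpleGraph V) [DecidableEq V] [G.LocallyFinite]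

/-- **DLR consistency in expectation form** (Friedli–Velenik 2017, Lemma 6.7, eq. (6.5), for the
Hamiltonian with a site-dependent field): for `Λ' ⊆ Λ`, `⟨F⟩^η_Λ` is an average of the inner
expectations `⟨F⟩^{η[τ₂]}_{Λ'}` over the spins `τ₂` of `Λ ∖ Λ'`; in particular, if all of these are
equal to `c`, so is `⟨F⟩^η_Λ`. [cite: FriedliVelenik2017, Lemma 6.7, eq. (6.5)] -/
theorem fieldExpect_fixed_eq_of_forall_inner_eq {Λ' Λ : Finset V} (hsub : Λ' ⊆ Λ)
    (η : SpinConfig V) (β : ℝ) (h : V → ℝ) {F : SpinConfig V → ℝ} (hF : Measurable F) {c : ℝ}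
    (hc : ∀ τ₂ : ↥(Λ \ Λ') → ℤˣ,
      fieldExpect G Λ' β h (.fixed (glue (Λ \ Λ') τ₂ (.fixed η))) F = c) :
    fieldExpect G Λ β h (.fixed η) F = c := by
  have hZ := fieldZ_pos G Λ β h (.fixed η)
  rw [fieldExpect_eq_sum_div G Λ β h _ hF, div_eq_iff hZ.ne', fieldZ_fixed_eq_sum G hsub η β h,
    sum_fieldWeight_fixed_eq_sum_sum G hsub η β h F, Finset.mul_sum]
  refine Finset.sum_congr rfl fun τ₂ _ => ?_
  have hin := hc τ₂
  rw [fieldExpect_eq_sum_div G Λ' β h _ hF, div_eq_iff (fieldZ_pos G Λ' β h _).ne'] at hin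
  rw [hin]
  ring

/-- **The FKG trick of Lemma 3.33, Lipschitz form**: for `β ≥ 0`, any field `h`, a finite set of
sites `K` and an observable `f` with `|f(σ') - f(σ)| ≤ M ∑_{k∈K} |σ'_k - σ_k|`,
`|⟨f⟩⁺_{Λ;β,h} - ⟨f⟩⁻_{Λ;β,h}| ≤ M ∑_{k∈K} (⟨σ_k⟩⁺_{Λ;β,h} - ⟨σ_k⟩⁻_{Λ;β,h})`: both
`M ∑_{k∈K} σ_k ± f` are nondecreasing, and `⟨·⟩⁻ ≤ ⟨·⟩⁺` on nondecreasing functions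
(Friedli–Velenik 2017, Lemma 3.33: "`∑_{i∈A} n_i - n_A` is non-decreasing", and the proof of
Theorem 3.34, (3.37)). [cite: FriedliVelenik2017, Lemma 3.33 and Theorem 3.34 (proof)] -/
theorem abs_fieldExpect_plus_sub_minus_le {β : ℝ} (hβ : 0 ≤ β) (Λ : Finset V) (h : V → ℝ)
    (K : Finset V) {M : ℝ} {f : SpinConfig V → ℝ} (hfm : Measurable f)
    (hf : ∀ σ σ' : SpinConfig V, |f σ' - f σ| ≤ M * ∑ k ∈ K, |spinAt k σ' - spinAt k σ|) :
    |fieldExpect G Λ β h .plus f - fieldExpect G Λ β h .minus f| ≤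
      M * ∑ k ∈ K, (fieldExpect G Λ β h .plus (spinAt k) - fieldExpect G Λ β h .minus (spinAt k)) := by
  set r : SpinConfig V → ℝ := fun σ => ∑ k ∈ K, spinAt k σ with hr
  have hrm : Measurable r := Finset.measurable_sum _ fun k _ => measurable_spinAt k
  have hr_mono : ∀ σ σ' : SpinConfig V, σ ≤ σ' →
      ∑ k ∈ K, |spinAt k σ' - spinAt k σ| = r σ' - r σ := fun σ σ' hle => by
    rw [hr, ← Finset.sum_sub_distrib]
    exact Finset.sum_congr rfl fun k _ => abs_of_nonneg (sub_nonneg.2 (spinAt_mono k hle))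
  have hmono₁ : Monotone fun σ => M * r σ - f σ := fun σ σ' hle => by
    have := (le_abs_self _).trans (hf σ σ')
    rw [hr_mono σ σ' hle] at this
    dsimp only
    linarith
  have hmono₂ : Monotone fun σ => M * r σ + f σ := fun σ σ' hle => by
    have := (neg_le_abs _).trans (hf σ σ')
    rw [hr_mono σ σ' hle] at this
    dsimp only
    linarith
  have hm₁ : Measurable fun σ => M * r σ - f σ := (hrm.const_mul M).sub hfm
  have hm₂ : Measurable fun σ => M * r σ + f σ := (hrm.const_mul M).add hfm
  have hle : (-1 : SpinConfig V) ≤ 1 := fun x => neg_one_le_intUnits _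
  have h₁ := fieldExpect_fixed_mono G hβ Λ h hle hmono₁ hm₁
  have h₂ := fieldExpect_fixed_mono G hβ Λ h hle hmono₂ hm₂
  have hexp : ∀ bc : BoundaryCondition V,
      fieldExpect G Λ β h bc (fun σ => M * r σ - f σ) =
        M * ∑ k ∈ K, fieldExpect G Λ β h bc (spinAt k) - fieldExpect G Λ β h bc f := fun bc => by
    rw [fieldExpect_sub G Λ β h bc (hrm.const_mul M) hfm, fieldExpect_const_mul G Λ β h bc M hrm,
      hr, fieldExpect_finset_sum G Λ β h bc K (fun k => spinAt k) fun k => measurable_spinAt k]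
  have hexp' : ∀ bc : BoundaryCondition V,
      fieldExpect G Λ β h bc (fun σ => M * r σ + f σ) =
        M * ∑ k ∈ K, fieldExpect G Λ β h bc (spinAt k) + fieldExpect G Λ β h bc f := fun bc => by
    rw [fieldExpect_add G Λ β h bc (hrm.const_mul M) hfm, fieldExpect_const_mul G Λ β h bc M hrm,
      hr, fieldExpect_finset_sum G Λ β h bc K (fun k => spinAt k) fun k => measurable_spinAt k]
  rw [hexp, hexp] at h₁
  rw [hexp', hexp'] at h₂
  show |fieldExpect G Λ β h (.fixed 1) f - fieldExpect G Λ β h (.fixed (-1)) f| ≤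
    M * ∑ k ∈ K, (fieldExpect G Λ β h (.fixed 1) (spinAt k) -
      fieldExpect G Λ β h (.fixed (-1)) (spinAt k))
  rw [Finset.sum_sub_distrib, mul_sub, abs_le]
  constructor <;> linarith

/-- **Insensitivity to the `±` boundary condition along a sequence of volumes**: if
`⟨σ_k⟩⁺_{Λₙ;β,h} - ⟨σ_k⟩⁻_{Λₙ;β,h} → 0` for every `k ∈ K`, then `⟨f⟩⁺_{Λₙ} - ⟨f⟩⁻_{Λₙ} → 0` for
every observable `f` of the spins in `K` (Friedli–Velenik 2017, proof of Theorem 3.34: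
`μ⁺ = μ⁻` as soon as the one-point functions agree). [cite: FriedliVelenik2017, Theorem 3.34 (proof)] -/
theorem tendsto_fieldExpect_plus_sub_minus_of_local {β : ℝ} (hβ : 0 ≤ β) (h : V → ℝ)
    (Λ : ℕ → Finset V) (K : Finset V) {f : SpinConfig V → ℝ} (hfm : Measurable f)
    (hloc : ∀ σ σ' : SpinConfig V, (∀ k ∈ K, σ k = σ' k) → f σ = f σ')
    (hK : ∀ k ∈ K, Tendsto (fun n => fieldExpect G (Λ n) β h .plus (spinAt k) -
      fieldExpect G (Λ n) β h .minus (spinAt k)) atTop (𝓝 0)) :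
    Tendsto (fun n => fieldExpect G (Λ n) β h .plus f - fieldExpect G (Λ n) β h .minus f)
      atTop (𝓝 0) := by
  obtain ⟨B, _, hB⟩ := exists_abs_le_of_local K hloc
  have hsum : Tendsto (fun n => B * ∑ k ∈ K, (fieldExpect G (Λ n) β h .plus (spinAt k) -
      fieldExpect G (Λ n) β h .minus (spinAt k))) atTop (𝓝 0) := by
    have := (tendsto_finsetSum K fun k hk => hK k hk).const_mul B
    simpa only [Finset.sum_const_zero, mul_zero] using this
  refine squeeze_zero_norm (fun n => ?_) hsum
  rw [Real.norm_eq_abs]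
  exact abs_fieldExpect_plus_sub_minus_le G hβ (Λ n) h K hfm (abs_sub_le_of_local K hB hloc)

/-- The edge boundary is monotone in the graph (for a fixed volume). [folklore] -/
theorem edgeBoundary_mono_graph {G₁ G₂ : SimpleGraph V} [G₁.LocallyFinite] [G₂.LocallyFinite]
    (hle : G₁ ≤ G₂) (Λ : Finset V) : edgeBoundary G₁ Λ ⊆ edgeBoundary G₂ Λ := fun e he => by
  rw [mem_edgeBoundary_iff] at he ⊢
  exact ⟨SimpleGraph.edgeSet_subset_edgeSet.2 hle he.1, he.2⟩

/-- Transport of the finite-volume uniqueness statement along a field-preserving automorphism: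
if `⟨σ_c⟩⁺_Λ - ⟨σ_c⟩⁻_Λ ≤ ε` for all `Λ ⊇ Λ₀`, then `⟨σ_{φc}⟩⁺_Λ - ⟨σ_{φc}⟩⁻_Λ ≤ ε` for all
`Λ ⊇ φ(Λ₀)` (periodicity, Friedli–Velenik 2017, proof of Prop. 3.29).
[cite: FriedliVelenik2017, Prop. 3.29 (proof)] -/
theorem forall_volume_plusMag_sub_minusMag_le_equiv {β : ℝ} {v : V → ℝ} (φ : V ≃ V)
    (hadj : ∀ x y, (G.Adj (φ x) (φ y) ↔ G.Adj x y)) (hφv : ∀ x, v (φ x) = v x) {c : V} {s ε : ℝ}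
    {Λ₀ : Finset V}
    (h : ∀ Λ' : Finset V, Λ₀ ⊆ Λ' → plusMag G β v Λ' c s - minusMag G β v Λ' c s ≤ ε) :
    ∀ Λ' : Finset V, Λ₀.map φ.toEmbedding ⊆ Λ' →
      plusMag G β v Λ' (φ c) s - minusMag G β v Λ' (φ c) s ≤ ε := by
  intro Λ' hΛ'
  obtain ⟨Λ₁, rfl⟩ := surjective_map_equiv φ Λ'
  dsimp only at hΛ' ⊢
  rw [plusMag_map_equiv φ hadj hφv, minusMag_map_equiv φ hadj hφv]
  exact h Λ₁ (Finset.map_subset_map.1 hΛ')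

end General

end Literature.Probability.LatticeModels


end
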